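import Summits.NavierStokesRegularity.NavierStokesRegularity.Theorems.HubbleDynamoNoSelfExcitedDynamoStubEnstrophyBalance
import HarnessLib

/-!
# Enstrophy evolution of an eternal backward-Leray flow in the uniform profile class
# (route `HubbleDynamo`, crux `NoSelfExcitedDynamo`, line `registered`, stub `stub_enstrophyEvolution`)

Helper file (all results proved) for the crux item stmt-NavierStokesRegularity-1934. For an eternal
classical solution `(U, P)` of Leray's backward system `∂ₛU + ½U + ½(y·∇)U + (U·∇)U + ∇P = ΔU`,
`div U = 0` on `ℝ × ℝ³` (`IsBackwardLeraySolutionOn univ 1 U P`) in the uniform profile class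
`(1+|y|)^{k+1}‖DᵏU(s)‖ ≤ K_k`, the enstrophy `E(s) = ∫|curl U(s)|²` is finite, bounded and Lipschitz
in `s`, and obeys the exact identity `E(s₁) − E(s₀) = 2∫_{s₀}^{s₁}(S − D_F − ¼E)` for `s₀ ≤ s₁`, with
`S = ∫⟪Ω,(DU)Ω⟫` the stretching integral and `D_F = ∫|DΩ|²_F` the Frobenius dissipation
(`Ω = curl U`; `stub_enstrophyEvolution`).

Proof. As in the sister file `…StubEnstrophyBalance` (whose profile-class bookkeeping
`enstrophy_decay`, `enstrophy_pointwise`, `enstrophy_slice_integrable`, `enstrophy_integrable_weight` is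
reused): the slice identity `∫⟪∂ₛΩ,Ω⟫ + ¼E + D_F = S` (`PineauVicol2026.enstrophy_slice`), Fubini on
`(s₀, s₁] × ℝ³` and the fundamental theorem of calculus in `s` with the `s`-uniform dominator
`|⟪∂ₛΩ,Ω⟫| ≤ A(1+|y|)⁻⁴` (read off the vorticity equation `IsBackwardLeraySolutionOn.vorticity_eq`),
which gives both `∫_{s₀}^{s₁}∫⟪∂ₛΩ,Ω⟫ = ½(E(s₁) − E(s₀))` and the Lipschitz bound
`|E(s₁) − E(s₀)| ≤ 2A(∫(1+|y|)⁻⁴)|s₁ − s₀|`.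
References: Pineau–Vicol 2026, (3.3)–(3.4), (7.12); Leray 1934, §20.
-/

noncomputable section

-- tree namespace `Summit.<S>.<S>.Theorems…` (summit = sub-problem), as in every Theorems file
set_option linter.dupNamespace false

open Set MeasureTheory Filter Topology InnerProductSpace Function
open scoped RealInnerProductSpace Laplacian ContDiff

namespace Summit.NavierStokesRegularity.NavierStokesRegularity.Theorems.NoSelfExcitedDynamo.Registered

open Literature.Analysis.FluidPDE

/-! ### The time-derivative density `⟪∂ₛΩ, Ω⟫`: slice identity, continuity, dominator -/

/-- **The slice identity in the profile class.** For an eternal backward-Leray flow whose slice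
`U(s)` lies in the profile class with constant `K`:
`∫⟪∂ₛΩ,Ω⟫ = S − D_F − ¼E` (`PineauVicol2026.enstrophy_slice`, its integrability inputs and the
amplitude bound `|U(s)| ≤ K` from `enstrophy_slice_integrable`). -/
theorem evolution_slice {U : ℝ → EuclideanSpace ℝ (Fin 3) → EuclideanSpace ℝ (Fin 3)}
    {P : ℝ → EuclideanSpace ℝ (Fin 3) → ℝ} (h : IsBackwardLeraySolutionOn univ 1 U P) (s : ℝ) {K : ℝ}
    (hK0 : 0 ≤ K)
    (hK : ∀ y, (1 + ‖y‖) * ‖U s y‖ ≤ K ∧ (1 + ‖y‖) ^ 2 * ‖fderiv ℝ (U s) y‖ ≤ K ∧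
      (1 + ‖y‖) ^ 3 * ‖fderiv ℝ (curl (U s)) y‖ ≤ K ∧ (1 + ‖y‖) ^ 4 * ‖(Δ (curl (U s))) y‖ ≤ K) :
    ∫ y, ⟪timeDerivWithin univ (vorticity U) s y, curl (U s) y⟫ =
      (∫ y, ⟪curl (U s) y, fderiv ℝ (U s) y (curl (U s) y)⟫) -
        (∫ y, frobeniusNormSq (fderiv ℝ (curl (U s)) y)) - (1 / 4) * ∫ y, ‖curl (U s) y‖ ^ 2 := by
  have hUs : ContDiff ℝ ∞ (U s) := h.smooth_velocity.contDiff_slice (mem_univ s)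
  obtain ⟨i1, -, i3, i4, i5, i6, hUb, -⟩ := enstrophy_slice_integrable (hUs.of_le (by norm_cast)) hK0 hK
  have e := PineauVicol2026.enstrophy_slice h s hUb i1 i4 i5 i6 i3
  linarith

/-- **The uniform dominator.** In the profile class with constant `K`, the density `⟪∂ₛΩ,Ω⟫` of an
eternal backward-Leray flow obeys `|⟪∂ₛΩ,Ω⟫| ≤ A(1+|y|)⁻⁴` uniformly in `s`,
`A = (K·κK + K + κK + K/2 + K·K)·κK`, `κ = ‖curlCLM‖` (vorticity equation + `enstrophy_pointwise`). -/
theorem evolution_dominator {U : ℝ → EuclideanSpace ℝ (Fin 3) → EuclideanSpace ℝ (Fin 3)}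
    {P : ℝ → EuclideanSpace ℝ (Fin 3) → ℝ} (h : IsBackwardLeraySolutionOn univ 1 U P) (s : ℝ) {K : ℝ}
    (hK0 : 0 ≤ K)
    (hK : ∀ y, (1 + ‖y‖) * ‖U s y‖ ≤ K ∧ (1 + ‖y‖) ^ 2 * ‖fderiv ℝ (U s) y‖ ≤ K ∧
      (1 + ‖y‖) ^ 3 * ‖fderiv ℝ (curl (U s)) y‖ ≤ K ∧ (1 + ‖y‖) ^ 4 * ‖(Δ (curl (U s))) y‖ ≤ K)
    (y : EuclideanSpace ℝ (Fin 3)) :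
    |⟪timeDerivWithin univ (vorticity U) s y, curl (U s) y⟫| ≤
      (K * (‖curlCLM‖ * K) + K + ‖curlCLM‖ * K + K / 2 + K * K) * (‖curlCLM‖ * K) * ((1 + ‖y‖) ^ 4)⁻¹ := by
  have eq := h.vorticity_eq uniqueDiffOn_univ (by simp) (mem_univ s) y
  simp only [vorticity_apply, convect_apply, one_smul] at eq
  have e' : timeDerivWithin univ (vorticity U) s y = fderiv ℝ (U s) y (curl (U s) y) + (Δ (curl (U s))) y -
      curl (U s) y - (1 / 2 : ℝ) • fderiv ℝ (curl (U s)) y y - fderiv ℝ (curl (U s)) y (U s y) := by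
    rw [← eq]; abel
  rw [e', ← div_eq_mul_inv, le_div_iff₀' (by positivity)]
  exact (mul_le_mul_of_nonneg_left (abs_real_inner_le_norm _ _) (by positivity)).trans
    (enstrophy_pointwise hK0 hK y).2

/-- **Joint continuity** of the density `(s, y) ↦ ⟪∂ₛΩ(s, y), Ω(s, y)⟫` of an eternal
backward-Leray flow (`U` is jointly smooth, hence so are `Ω = curl U` and `∂ₛΩ`). -/
theorem evolution_continuous {U : ℝ → EuclideanSpace ℝ (Fin 3) → EuclideanSpace ℝ (Fin 3)}
    {P : ℝ → EuclideanSpace ℝ (Fin 3) → ℝ} (h : IsBackwardLeraySolutionOn univ 1 U P) :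
    Continuous (uncurry fun s y => ⟪timeDerivWithin univ (vorticity U) s y, curl (U s) y⟫) := by
  have hΩsm : IsSmoothSpaceTimeOn univ (vorticity U) :=
    h.smooth_velocity.isSmoothSpaceTimeOn_vorticity uniqueDiffOn_univ
  have hΩc := PineauVicol2026.continuous_uncurry_of_isSmoothSpaceTimeOn_univ hΩsm
  have hTc := PineauVicol2026.continuous_uncurry_of_isSmoothSpaceTimeOn_univ
    (hΩsm.timeDerivWithin uniqueDiffOn_univ)
  have : (uncurry fun s y => ⟪timeDerivWithin univ (vorticity U) s y, curl (U s) y⟫) =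
      fun z : ℝ × EuclideanSpace ℝ (Fin 3) =>
        ⟪timeDerivWithin univ (vorticity U) z.1 z.2, vorticity U z.1 z.2⟫ := by
    funext z; simp [uncurry, vorticity_apply]
  rw [this]; exact hTc.inner hΩc

/-! ### Fubini and the fundamental theorem of calculus in `s` -/

/-- **Time integration of the density.** For an eternal backward-Leray flow in the profile class
with constant `K` and `s₀ ≤ s₁`: `s ↦ ∫⟪∂ₛΩ,Ω⟫` is interval integrable on `[s₀, s₁]` and
`∫_{s₀}^{s₁}∫⟪∂ₛΩ,Ω⟫ dy ds = ½E(s₁) − ½E(s₀)` (Fubini on `(s₀, s₁] × ℝ³` with the dominator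
`evolution_dominator`, then `d/ds ½|Ω|² = ⟪∂ₛΩ,Ω⟫` pointwise in `y`). -/
theorem evolution_integral {U : ℝ → EuclideanSpace ℝ (Fin 3) → EuclideanSpace ℝ (Fin 3)}
    {P : ℝ → EuclideanSpace ℝ (Fin 3) → ℝ} (h : IsBackwardLeraySolutionOn univ 1 U P) {K : ℝ} (hK0 : 0 ≤ K)
    (hK : ∀ s y, (1 + ‖y‖) * ‖U s y‖ ≤ K ∧ (1 + ‖y‖) ^ 2 * ‖fderiv ℝ (U s) y‖ ≤ K ∧
      (1 + ‖y‖) ^ 3 * ‖fderiv ℝ (curl (U s)) y‖ ≤ K ∧ (1 + ‖y‖) ^ 4 * ‖(Δ (curl (U s))) y‖ ≤ K)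
    {s₀ s₁ : ℝ} (hle : s₀ ≤ s₁) :
    IntervalIntegrable (fun s => ∫ y, ⟪timeDerivWithin univ (vorticity U) s y, curl (U s) y⟫) volume s₀ s₁ ∧
    ∫ s in s₀..s₁, (∫ y, ⟪timeDerivWithin univ (vorticity U) s y, curl (U s) y⟫) =
      (1 / 2) * (∫ y, ‖curl (U s₁) y‖ ^ 2) - (1 / 2) * ∫ y, ‖curl (U s₀) y‖ ^ 2 := by
  have hsm : IsSmoothSpaceTimeOn univ U := h.smooth_velocity
  have hU3 : ∀ s, ContDiff ℝ 3 (U s) := fun s => (hsm.contDiff_slice (mem_univ s)).of_le (by norm_cast)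
  have hΩsm : IsSmoothSpaceTimeOn univ (vorticity U) := hsm.isSmoothSpaceTimeOn_vorticity uniqueDiffOn_univ
  have hE : ∀ s, Integrable (fun y => ‖curl (U s) y‖ ^ 2) volume := fun s =>
    (enstrophy_slice_integrable (hU3 s) hK0 (hK s)).1
  set f : ℝ → EuclideanSpace ℝ (Fin 3) → ℝ := fun s y => ⟪timeDerivWithin univ (vorticity U) s y, curl (U s) y⟫
    with hf
  have hfc : Continuous (uncurry f) := evolution_continuous h
  set A : ℝ := (K * (‖curlCLM‖ * K) + K + ‖curlCLM‖ * K + K / 2 + K * K) * (‖curlCLM‖ * K) with hA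
  have hdomf : ∀ s y, |f s y| ≤ A * ((1 + ‖y‖) ^ 4)⁻¹ := fun s y => evolution_dominator h s hK0 (hK s) y
  -- integrability on the strip `(s₀, s₁] × ℝ³`
  set μ : Measure ℝ := volume.restrict (Ioc s₀ s₁) with hμ
  have h1i : Integrable (fun _ : ℝ => (1 : ℝ)) μ := by
    have : IntegrableOn (fun _ : ℝ => (1 : ℝ)) (Ioc s₀ s₁) (volume : Measure ℝ) :=
      integrableOn_const measure_Ioc_lt_top.ne
    rw [hμ]; exact this
  have hFi : Integrable (uncurry f) (μ.prod volume) :=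
    (h1i.mul_prod (enstrophy_integrable_weight A)).mono' hfc.aestronglyMeasurable
      (Eventually.of_forall fun z => by rw [one_mul, Real.norm_eq_abs]; exact hdomf z.1 z.2)
  -- Fubini and the fundamental theorem of calculus in `s`, pointwise in `y`
  have hFTC : ∀ y, ∫ s, f s y ∂μ = (1 / 2) * ‖curl (U s₁) y‖ ^ 2 - (1 / 2) * ‖curl (U s₀) y‖ ^ 2 := by
    intro y
    rw [hμ, ← intervalIntegral.integral_of_le hle]
    have hderiv : ∀ s ∈ uIcc s₀ s₁, HasDerivAt (fun s => (1 / 2) * ‖vorticity U s y‖ ^ 2) (f s y) s := by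
      intro s _
      have h1 : HasDerivAt (fun s => vorticity U s y) (timeDerivWithin univ (vorticity U) s y) s :=
        hasDerivWithinAt_univ.1 (hΩsm.hasDerivWithinAt_timeDerivWithin uniqueDiffOn_univ (mem_univ s) y)
      refine ((h1.norm_sq).const_mul (1 / 2 : ℝ)).congr_deriv ?_
      simp only [hf, vorticity_apply, real_inner_comm (curl (U s) y)]
      ring
    rw [intervalIntegral.integral_eq_sub_of_hasDerivAt hderiv
      ((hfc.comp (continuous_id.prodMk continuous_const)).intervalIntegrable _ _)]
    simp [vorticity_apply]
  refine ⟨?_, ?_⟩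
  · rw [intervalIntegrable_iff_integrableOn_Ioc_of_le hle, IntegrableOn, ← hμ]
    exact hFi.integral_prod_left
  · rw [intervalIntegral.integral_of_le hle, ← hμ, integral_integral_swap hFi,
      integral_congr_ae (Eventually.of_forall hFTC),
      integral_sub ((hE s₁).const_mul _) ((hE s₀).const_mul _), integral_const_mul, integral_const_mul]

/-! ### The stub -/

/-- **`stub_enstrophyEvolution`** (stub T3 of the line `registered` of the crux `NoSelfExcitedDynamo`;
Pineau–Vicol 2026 (7.12) in integrated form). For an eternal solution of the backward Leray system in
the uniform profile class, with `E(s) = ∫‖curl U(s)‖²`, `D_F(s) = ∫|D curl U(s)|²_F`,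
`S(s) = ∫⟪curl U(s), (DU(s)) curl U(s)⟫`: `E(s)` is finite and bounded in `s`, `E` is Lipschitz, and
for `s₀ ≤ s₁` the integrand `S − D_F − ¼E` is interval integrable with
`E(s₁) − E(s₀) = 2∫_{s₀}^{s₁}(S − D_F − ¼E)`: the slice identity `∫⟪∂ₛΩ,Ω⟫ = S − D_F − ¼E`
(`evolution_slice`) integrated in `s` (`evolution_integral`); the Lipschitz bound with constant
`2A∫(1+|y|)⁻⁴` from the dominator `evolution_dominator`. -/
theorem stub_enstrophyEvolution :
    ∀ (U : ℝ → EuclideanSpace ℝ (Fin 3) → EuclideanSpace ℝ (Fin 3)) (P : ℝ → EuclideanSpace ℝ (Fin 3) → ℝ),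
      IsBackwardLeraySolutionOn univ 1 U P →
      (∀ k : ℕ, ∃ K : ℝ, ∀ s y, (1 + ‖y‖) ^ (k + 1) * ‖iteratedFDeriv ℝ k (U s) y‖ ≤ K) →
      (∀ s, Integrable (fun y => ‖curl (U s) y‖ ^ 2)) ∧
      (∃ M : ℝ, ∀ s, ∫ y, ‖curl (U s) y‖ ^ 2 ≤ M) ∧
      (∃ B : ℝ, ∀ s₀ s₁ : ℝ,
        |(∫ y, ‖curl (U s₁) y‖ ^ 2) - ∫ y, ‖curl (U s₀) y‖ ^ 2| ≤ B * |s₁ - s₀|) ∧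
      (∀ s₀ s₁ : ℝ, s₀ ≤ s₁ →
        IntervalIntegrable (fun s =>
          (∫ y, ⟪curl (U s) y, fderiv ℝ (U s) y (curl (U s) y)⟫) -
            (∫ y, frobeniusNormSq (fderiv ℝ (curl (U s)) y)) - (1 / 4) * ∫ y, ‖curl (U s) y‖ ^ 2)
          volume s₀ s₁ ∧
        (∫ y, ‖curl (U s₁) y‖ ^ 2) - (∫ y, ‖curl (U s₀) y‖ ^ 2) =
          2 * ∫ s in s₀..s₁,
            ((∫ y, ⟪curl (U s) y, fderiv ℝ (U s) y (curl (U s) y)⟫) -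
              (∫ y, frobeniusNormSq (fderiv ℝ (curl (U s)) y)) - (1 / 4) * ∫ y, ‖curl (U s) y‖ ^ 2)) := by
  intro U P h hdec
  have hsm : IsSmoothSpaceTimeOn univ U := h.smooth_velocity
  have hU3 : ∀ s, ContDiff ℝ 3 (U s) := fun s => (hsm.contDiff_slice (mem_univ s)).of_le (by norm_cast)
  obtain ⟨K, hK0, hK⟩ := enstrophy_decay hU3 hdec
  set κ : ℝ := ‖curlCLM‖ with hκ
  -- finiteness and boundedness of the enstrophy
  have hE : ∀ s, Integrable (fun y => ‖curl (U s) y‖ ^ 2) volume := fun s =>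
    (enstrophy_slice_integrable (hU3 s) hK0 (hK s)).1
  have hΩ2 : ∀ s y, ‖curl (U s) y‖ ^ 2 ≤ (κ * K) ^ 2 * ((1 + ‖y‖) ^ 4)⁻¹ := fun s =>
    (enstrophy_slice_integrable (hU3 s) hK0 (hK s)).2.2.2.2.2.2.2
  -- the density `⟪∂ₛΩ,Ω⟫`, its slice identity and its slice bound
  set f : ℝ → EuclideanSpace ℝ (Fin 3) → ℝ := fun s y => ⟪timeDerivWithin univ (vorticity U) s y, curl (U s) y⟫
    with hf
  have hslice : (fun s => (∫ y, ⟪curl (U s) y, fderiv ℝ (U s) y (curl (U s) y)⟫) -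
      (∫ y, frobeniusNormSq (fderiv ℝ (curl (U s)) y)) - (1 / 4) * ∫ y, ‖curl (U s) y‖ ^ 2) =
      fun s => ∫ y, f s y := funext fun s => (evolution_slice h s hK0 (hK s)).symm
  set A : ℝ := (K * (κ * K) + K + κ * K + K / 2 + K * K) * (κ * K) with hA
  have hdomf : ∀ s y, |f s y| ≤ A * ((1 + ‖y‖) ^ 4)⁻¹ := fun s y => evolution_dominator h s hK0 (hK s) y
  have hfc : Continuous (uncurry f) := evolution_continuous h
  have hfi : ∀ s, Integrable (f s) := fun s =>
    (enstrophy_integrable_weight A).mono' (hfc.comp (continuous_const.prodMk continuous_id)).aestronglyMeasurable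
      (Eventually.of_forall fun y => by rw [Real.norm_eq_abs]; exact hdomf s y)
  set W : ℝ := ∫ y : EuclideanSpace ℝ (Fin 3), A * ((1 + ‖y‖) ^ 4)⁻¹ with hW
  have hfb : ∀ s, ‖∫ y, f s y‖ ≤ W := fun s =>
    (norm_integral_le_integral_norm _).trans
      (integral_mono (hfi s).norm (enstrophy_integrable_weight A) fun y => by
        rw [Real.norm_eq_abs]; exact hdomf s y)
  refine ⟨hE, ⟨_, fun s => integral_mono (hE s) (enstrophy_integrable_weight _) (hΩ2 s)⟩,
    ⟨2 * W, fun s₀ s₁ => ?_⟩, fun s₀ s₁ hle => ?_⟩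
  · -- Lipschitz bound
    have key : ∀ a b : ℝ, a ≤ b → |(∫ y, ‖curl (U b) y‖ ^ 2) - ∫ y, ‖curl (U a) y‖ ^ 2| ≤
        (2 * W) * |b - a| := by
      intro a b hab
      obtain ⟨-, hId⟩ := evolution_integral h hK0 hK hab
      have e : (∫ y, ‖curl (U b) y‖ ^ 2) - (∫ y, ‖curl (U a) y‖ ^ 2) = 2 * ∫ s in a..b, ∫ y, f s y := by
        simp only [hf] at hId ⊢; linarith
      rw [e, abs_mul, abs_two, mul_assoc]
      refine mul_le_mul_of_nonneg_left ?_ two_pos.le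
      rw [← Real.norm_eq_abs]
      exact intervalIntegral.norm_integral_le_of_norm_le_const fun s _ => hfb s
    rcases le_total s₀ s₁ with hle | hle
    · exact key s₀ s₁ hle
    · rw [abs_sub_comm, abs_sub_comm s₁ s₀]; exact key s₁ s₀ hle
  · -- the identity
    obtain ⟨hI, hId⟩ := evolution_integral h hK0 hK hle
    rw [hslice]
    refine ⟨hI, ?_⟩
    simp only [hf] at hId ⊢
    linarith

end Summit.NavierStokesRegularity.NavierStokesRegularity.Theorems.NoSelfExcitedDynamo.Registered

end
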